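import Literature.Geometry.Riemannian.SphericalCapMap
import Literature.Geometry.Riemannian.RoundSphere
import Literature.Geometry.Riemannian.ChangGurskyYangProofs
import Literature.Geometry.Lorentzian.CurvatureNaturality
import HarnessLib

/-!
# The inverse stereographic projection is conformal; the metrics `λ_R² δ` on `ℝⁿ⁺¹` isometric to round spheres
(topic `Geometry/Riemannian`)

Infrastructure for the "big sphere" step in the proof of
`Literature.Geometry.Riemannian.Sweeney2026_pscMeanConvex` (Sweeney 2026, Prop. 1.2, after
Lawson–Michelsohn 1984): a compact domain of `ℝⁿ⁺¹` whose boundary has positive mean curvature for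
the FLAT metric is mapped by `x ↦ σ⁻¹(x/R)` (inverse stereographic projection after shrinking by a
large factor `R`) onto a small domain of the round `Sⁿ⁺¹`, where it inherits positive scalar
curvature and — the round metric pulled back being the conformally flat `λ_R² δ` with
`λ_R ≈ 1/R` nearly constant on bounded sets — still has mean-convex boundary
(`HypersurfaceConformal.lean`: `Ĥ = H/λ + n dλ(ν)/λ²`). Everything here is PROVED:

* `stereoInvAmb v` — Mathlib's inverse stereographic projection from the pole `v`
  (`stereographic'_symm_apply`) written with the isometric embedding `e = capEmb v : ℝⁿ⁺¹ → v^⊥`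
  of `SphericalCapMap.lean`: `w ↦ (‖w‖² + 4)⁻¹ (4 e w + (‖w‖² - 4) v)` (`coe_stereographic'_symm`);
  its differential `stereoInvDeriv v w : a ↦ (4/q) e a + ⟪w, a⟫ (-(8/q²) e w + (16/q²) v)`,
  `q = ‖w‖² + 4` (`hasFDerivAt_stereoInvAmb`), which is **conformal**:
  `⟪dS a, dS b⟫ = (4/q)² ⟪a, b⟫` (`inner_stereoInvDeriv`), hence injective;
* `stereoScaled v R : ℝⁿ⁺¹ → sphere (0 : V) 1`, `x ↦ σᵥ⁻¹(x/R)` — smooth (the chart inverse is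
  smooth, `contMDiffOn_chart_symm`), an immersion for `R ≠ 0`, with
  `dι ∘ d(stereoScaled) = dS_{x/R} ∘ R⁻¹` (`mvfderiv_coe_mfderiv_stereoScaled`);
* `stereoFactor R x = 4R/(‖x‖² + 4R²)` — the conformal factor, `> 0` for `R > 0`, with
  `dλ_R(x) a = -8R⟪x, a⟫/(‖x‖² + 4R²)²` (`hasFDerivAt_stereoFactor`, `mvfderiv_stereoFactor`);
* `roundMetric_val_mfderiv_stereoScaled` — `g_round(dΨ a, dΨ b) = λ_R(x)² ⟪a, b⟫`;
* `stereoMetric v hR` (an `abbrev` for `(roundMetric V).comap … (stereoScaled v R) …`) — the metric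
  `λ_R² δ` on `ℝⁿ⁺¹` as the pullback of the round metric (`stereoMetric_apply`,
  `stereoMetric_val_eq_smul`: `= λ_R² •` Euclidean metric, fibrewise), of positive scalar curvature
  (`scalarCurvature_stereoMetric_pos`, by naturality `scalarCurvature_comap` and
  `scalarCurvature_roundMetric_pos`).

Classical (conformality of the stereographic projection, e.g. Lee 2018, Prop. 3.5 / Problem 3-6);
the formalization follows Mathlib's `Geometry/Manifold/Instances/Sphere.lean`.

## References

* J. M. Lee, *Introduction to Riemannian Manifolds*, 2nd ed. (2018), Ch. 3 (the round sphere in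
  stereographic coordinates, conformally flat: `4|dx|²/(1+|x|²)²`). [Lee2018]
* H. B. Lawson, M.-L. Michelsohn, *Embedding and surrounding with positive mean curvature*,
  Invent. Math. 77 (1984) 399–419. [LawsonMichelsohn1984]
* P. Sweeney Jr., *Positive curvature conditions on contractible manifolds*, Math. Ann. (2026)
  = arXiv:2507.15719, Prop. 1.2. [Sweeney2026]
-/

noncomputable section

open Bundle Set Function Metric Module Filter
open scoped Manifold ContDiff Topology RealInnerProductSpace

namespace Literature.Geometry.Riemannian

open Lorentzian Lorentzian.PseudoRiemannianMetric

variable {V : Type*} [NormedAddCommGroup V] [InnerProductSpace ℝ V] {n : ℕ}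

/-- Local notation: the model space `ℝⁿ⁺¹`. -/
local notation "𝔼" => EuclideanSpace ℝ (Fin (n + 1))

section StereoInv

variable [Fact (finrank ℝ V = n + 1 + 1)] (v : sphere (0 : V) 1)

/-- Mathlib's inverse stereographic projection from the pole `v`, `ℝⁿ⁺¹ → V`, written with the
isometric embedding `e = capEmb v : ℝⁿ⁺¹ → v^⊥` of `SphericalCapMap.lean`:
`w ↦ (‖w‖² + 4)⁻¹ (4 e w + (‖w‖² - 4) v)` (`stereographic'_symm_apply`; the equator is
`‖w‖ = 2`). [folklore] -/
def stereoInvAmb (w : 𝔼) : V :=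
  (‖w‖ ^ 2 + 4)⁻¹ • ((4 : ℝ) • capEmb v w + (‖w‖ ^ 2 - 4) • (v : V))

/-- `stereoInvAmb` IS the inverse of Mathlib's chart `stereographic'`, read in `V`. [folklore] -/
theorem coe_stereographic'_symm (w : 𝔼) :
    ((stereographic' (n + 1) v).symm w : V) = stereoInvAmb v w := by
  rw [stereographic'_symm_apply]
  simp only [smul_smul]
  rw [stereoInvAmb, ← norm_capEmb v w, smul_add, smul_smul, smul_smul]
  rfl

omit [Fact (finrank ℝ V = n + 1 + 1)] in
/-- `‖w‖² + 4 > 0`. [folklore] -/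
theorem normSq_add_four_pos (w : 𝔼) : 0 < ‖w‖ ^ 2 + 4 := by positivity

/-- The differential of the inverse stereographic projection at `w`:
`a ↦ (4/q) e a + ⟪w, a⟫ (-(8/q²) e w + (16/q²) v)`, `q = ‖w‖² + 4`. [folklore] -/
def stereoInvDeriv (w : 𝔼) : 𝔼 →L[ℝ] V :=
  (4 / (‖w‖ ^ 2 + 4)) • capEmb v +
    (innerSL ℝ w).smulRight (-(8 / (‖w‖ ^ 2 + 4) ^ 2) • capEmb v w +
      (16 / (‖w‖ ^ 2 + 4) ^ 2) • (v : V))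

/-- Pointwise formula for `stereoInvDeriv`. [folklore] -/
theorem stereoInvDeriv_apply (w a : 𝔼) : stereoInvDeriv v w a =
    (4 / (‖w‖ ^ 2 + 4)) • capEmb v a +
      ⟪w, a⟫ • (-(8 / (‖w‖ ^ 2 + 4) ^ 2) • capEmb v w + (16 / (‖w‖ ^ 2 + 4) ^ 2) • (v : V)) := by
  simp only [stereoInvDeriv, add_apply, smul_apply, ContinuousLinearMap.smulRight_apply,
    innerSL_apply_apply]

/-- **The inverse stereographic projection has differential `stereoInvDeriv`.** [folklore] -/
theorem hasFDerivAt_stereoInvAmb (w : 𝔼) :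
    HasFDerivAt (stereoInvAmb (n := n) v) (stereoInvDeriv v w) w := by
  have hq := normSq_add_four_pos (n := n) w
  have h1 : HasFDerivAt (fun w : 𝔼 ↦ ‖w‖ ^ 2 + 4) (2 • innerSL ℝ w) w :=
    (hasStrictFDerivAt_norm_sq w).hasFDerivAt.add_const 4
  have h2 := (hasDerivAt_inv hq.ne').comp_hasFDerivAt w h1
  have h3 : HasFDerivAt (fun w : 𝔼 ↦ ‖w‖ ^ 2 - 4) (2 • innerSL ℝ w) w :=
    (hasStrictFDerivAt_norm_sq w).hasFDerivAt.sub_const 4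
  have h4 : HasFDerivAt (fun w : 𝔼 ↦ (4 : ℝ) • capEmb v w + (‖w‖ ^ 2 - 4) • (v : V))
      ((4 : ℝ) • capEmb (n := n) v + (2 • innerSL ℝ w).smulRight (v : V)) w :=
    ((capEmb (n := n) v).hasFDerivAt.const_smul (4 : ℝ)).add (h3.smul_const (v : V))
  have h5 : HasFDerivAt (stereoInvAmb (n := n) v) ((‖w‖ ^ 2 + 4)⁻¹ •
      ((4 : ℝ) • capEmb (n := n) v + (2 • innerSL ℝ w).smulRight (v : V)) +
      ((-((‖w‖ ^ 2 + 4) ^ 2)⁻¹) • (2 • innerSL ℝ w)).smulRight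
        ((4 : ℝ) • capEmb v w + (‖w‖ ^ 2 - 4) • (v : V))) w := h2.smul h4
  refine h5.congr_fderiv ?_
  ext a
  simp only [stereoInvDeriv, add_apply, smul_apply, ContinuousLinearMap.smulRight_apply,
    innerSL_apply_apply, nsmul_eq_mul, Nat.cast_ofNat, smul_add, smul_smul, smul_eq_mul]
  match_scalars
  · field_simp
  · field_simp
    ring
  · field_simp
    ring

/-- **The inverse stereographic projection is conformal** with factor `4/(‖w‖² + 4)`:
`⟪dS(a), dS(b)⟫ = (4/(‖w‖² + 4))² ⟪a, b⟫` (`e` is isometric onto `v^⊥`). [folklore] -/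
theorem inner_stereoInvDeriv (w a b : 𝔼) :
    ⟪stereoInvDeriv v w a, stereoInvDeriv v w b⟫ = (4 / (‖w‖ ^ 2 + 4)) ^ 2 * ⟪a, b⟫ := by
  have hq := normSq_add_four_pos (n := n) w
  rw [stereoInvDeriv_apply, stereoInvDeriv_apply]
  simp only [inner_add_left, inner_add_right, inner_smul_left, inner_smul_right,
    inner_capEmb_capEmb, inner_capEmb_pole, inner_pole_capEmb,
    real_inner_self_eq_norm_sq, conj_trivial, real_inner_comm a w, real_inner_comm b w, norm_capEmb,
    norm_eq_of_mem_sphere]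
  field_simp
  ring

end StereoInv

/-! ### The scaled inverse stereographic map `x ↦ σᵥ⁻¹(x/R)` and its conformally flat pullback metric -/

section StereoScaled

variable [Fact (finrank ℝ V = n + 1 + 1)] (v : sphere (0 : V) 1)

/-- From conformality, `stereoInvDeriv v w` is injective. [folklore] -/
theorem stereoInvDeriv_injective (w : 𝔼) : Injective (stereoInvDeriv (n := n) v w) := by
  refine (injective_iff_map_eq_zero (stereoInvDeriv (n := n) v w)).2 fun a ha ↦ ?_
  have h := inner_stereoInvDeriv v w a a
  rw [ha, inner_zero_left] at h
  have hq := normSq_add_four_pos (n := n) w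
  have h4 : (4 / (‖w‖ ^ 2 + 4)) ^ 2 ≠ 0 := by positivity
  rw [← norm_eq_zero, ← sq_eq_zero_iff, ← real_inner_self_eq_norm_sq]
  exact (mul_eq_zero.1 h.symm).resolve_left h4

/-- **The scaled inverse stereographic map** `ℝⁿ⁺¹ → Sⁿ⁺¹`, `x ↦ σᵥ⁻¹ (x/R)` (Mathlib's chart
`stereographic'` from the pole `v`): for large `R` it spreads a bounded set over a small
neighbourhood of `-v`, where the round metric, pulled back, is almost `R⁻²` times the flat one.
[folklore] -/
def stereoScaled (R : ℝ) (x : 𝔼) : sphere (0 : V) 1 :=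
  (stereographic' (n + 1) v).symm (R⁻¹ • x)

/-- The scaled inverse stereographic map read in `V`. [folklore] -/
theorem coe_stereoScaled (R : ℝ) (x : 𝔼) :
    (stereoScaled v R x : V) = stereoInvAmb (n := n) v (R⁻¹ • x) :=
  coe_stereographic'_symm v _

/-- Mathlib's `stereographic' (n + 1) v` is the preferred chart of the sphere at `-v`. [folklore] -/
theorem stereographic'_eq_chartAt : stereographic' (n + 1) v = chartAt 𝔼 (-v) := by
  change _ = stereographic' (n + 1) (-(-v))
  rw [neg_neg]

/-- The inverse of the stereographic chart is smooth on all of `ℝⁿ⁺¹` (its target). [folklore] -/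
theorem contMDiff_stereographic'_symm :
    ContMDiff 𝓘(ℝ, 𝔼) (𝓡 (n + 1)) ∞ (stereographic' (n + 1) v).symm := by
  have h := contMDiffOn_chart_symm (I := 𝓡 (n + 1)) (n := ∞) (x := -v) (H := 𝔼)
  rw [← stereographic'_eq_chartAt, stereographic'_target] at h
  exact contMDiffOn_univ.1 h

/-- The scaled inverse stereographic map is smooth. [folklore] -/
theorem contMDiff_stereoScaled (R : ℝ) : ContMDiff 𝓘(ℝ, 𝔼) (𝓡 (n + 1)) ∞ (stereoScaled (n := n) v R) :=
  (contMDiff_stereographic'_symm v).comp (contDiff_id.const_smul R⁻¹).contMDiff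

/-- Its differential read in `V`: `dι (d(σ⁻¹(·/R)) a) = dS_{x/R}(a/R)`. [folklore] -/
theorem mvfderiv_coe_mfderiv_stereoScaled (R : ℝ) (x a : 𝔼) :
    mvfderiv (𝓡 (n + 1)) (Subtype.val : sphere (0 : V) 1 → V) (stereoScaled v R x)
      (mfderiv 𝓘(ℝ, 𝔼) (𝓡 (n + 1)) (stereoScaled (n := n) v R) x a) =
        stereoInvDeriv v (R⁻¹ • x) (R⁻¹ • a) := by
  have h1 : HasMFDerivAt 𝓘(ℝ, 𝔼) 𝓘(ℝ, V)
      ((Subtype.val : sphere (0 : V) 1 → V) ∘ stereoScaled (n := n) v R) x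
      ((mfderiv (𝓡 (n + 1)) 𝓘(ℝ, V) (Subtype.val : sphere (0 : V) 1 → V)
        (stereoScaled v R x)).comp (mfderiv 𝓘(ℝ, 𝔼) (𝓡 (n + 1)) (stereoScaled (n := n) v R) x)) :=
    ((contMDiff_coe_sphere (stereoScaled v R x)).mdifferentiableAt one_ne_zero).hasMFDerivAt.comp x
      ((contMDiff_stereoScaled v R x).mdifferentiableAt (by simp)).hasMFDerivAt
  have h2 : HasFDerivAt ((Subtype.val : sphere (0 : V) 1 → V) ∘ stereoScaled (n := n) v R)
      ((stereoInvDeriv v (R⁻¹ • x)).comp (R⁻¹ • ContinuousLinearMap.id ℝ 𝔼)) x := by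
    have h := (hasFDerivAt_stereoInvAmb (n := n) v (R⁻¹ • x)).comp x
      ((hasFDerivAt_id x).const_smul R⁻¹)
    refine h.congr_of_eventuallyEq (Eventually.of_forall fun y ↦ ?_)
    exact coe_stereoScaled v R y
  have h3 := h1.mfderiv.symm.trans h2.hasMFDerivAt.mfderiv
  exact congrArg (fun f : 𝔼 →L[ℝ] V ↦ f a) h3

/-- The scaled inverse stereographic map is an immersion for `R ≠ 0`. [folklore] -/
theorem mfderiv_stereoScaled_injective {R : ℝ} (hR : R ≠ 0) (x : 𝔼) :
    Injective (mfderiv 𝓘(ℝ, 𝔼) (𝓡 (n + 1)) (stereoScaled (n := n) v R) x) := fun a b hab ↦ by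
  have h := congrArg (mvfderiv (𝓡 (n + 1)) (Subtype.val : sphere (0 : V) 1 → V)
    (stereoScaled v R x)) hab
  rw [mvfderiv_coe_mfderiv_stereoScaled, mvfderiv_coe_mfderiv_stereoScaled] at h
  exact smul_right_injective 𝔼 (inv_ne_zero hR) (stereoInvDeriv_injective v _ h)

omit [Fact (finrank ℝ V = n + 1 + 1)] in
/-- **The conformal factor** of the scaled stereographic map: `λ_R(x) = 4R/(‖x‖² + 4R²)`
(`= R⁻¹ · 4/(‖x/R‖² + 4)`). [folklore] -/
def stereoFactor (R : ℝ) (x : 𝔼) : ℝ := 4 * R / (‖x‖ ^ 2 + 4 * R ^ 2)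

omit [Fact (finrank ℝ V = n + 1 + 1)] in
/-- `λ_R > 0` for `R > 0`. [folklore] -/
theorem stereoFactor_pos {R : ℝ} (hR : 0 < R) (x : 𝔼) : 0 < stereoFactor (n := n) R x := by
  unfold stereoFactor; positivity

omit [Fact (finrank ℝ V = n + 1 + 1)] in
/-- The differential of the conformal factor: `dλ_R(x) a = -8R⟪x, a⟫/(‖x‖² + 4R²)²`. [folklore] -/
theorem hasFDerivAt_stereoFactor (R : ℝ) (x : 𝔼) :
    HasFDerivAt (stereoFactor (n := n) R)
      ((-(4 * R) / (‖x‖ ^ 2 + 4 * R ^ 2) ^ 2) • (2 • innerSL ℝ x)) x := by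
  have hx : (‖x‖ ^ 2 + 4 * R ^ 2) ≠ 0 ∨ R = 0 := by
    by_cases hR : R = 0
    · exact Or.inr hR
    · exact Or.inl (by positivity)
  rcases hx with hx | hR
  · have h1 : HasFDerivAt (fun x : 𝔼 ↦ ‖x‖ ^ 2 + 4 * R ^ 2) (2 • innerSL ℝ x) x :=
      (hasStrictFDerivAt_norm_sq x).hasFDerivAt.add_const _
    have h2 := ((hasDerivAt_inv hx).comp_hasFDerivAt x h1).const_mul (4 * R)
    refine h2.congr_fderiv ?_ |>.congr_of_eventuallyEq (Eventually.of_forall fun y ↦ ?_)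
    · ext a
      simp only [smul_apply, nsmul_eq_mul, Nat.cast_ofNat, smul_eq_mul, innerSL_apply_apply]
      ring
    · simp only [stereoFactor, comp_apply, div_eq_mul_inv]
  · subst hR
    have h0 : stereoFactor (n := n) 0 = fun _ ↦ 0 := by
      funext y; simp [stereoFactor]
    rw [h0]
    simpa using hasFDerivAt_const (0 : ℝ) x

omit [Fact (finrank ℝ V = n + 1 + 1)] in
/-- The conformal factor is differentiable (as a function on the manifold `ℝⁿ⁺¹`). [folklore] -/
theorem mdifferentiableAt_stereoFactor (R : ℝ) (x : 𝔼) :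
    MDifferentiableAt 𝓘(ℝ, 𝔼) 𝓘(ℝ, ℝ) (stereoFactor (n := n) R) x :=
  (hasFDerivAt_stereoFactor R x).hasMFDerivAt.mdifferentiableAt

omit [Fact (finrank ℝ V = n + 1 + 1)] in
/-- `dλ_R(x) a = -8R⟪x, a⟫/(‖x‖² + 4R²)²`, in the manifold-derivative form used by the
conformal-change lemmas. [folklore] -/
theorem mvfderiv_stereoFactor (R : ℝ) (x a : 𝔼) :
    mvfderiv 𝓘(ℝ, 𝔼) (stereoFactor (n := n) R) x a =
      -(8 * R * ⟪x, a⟫) / (‖x‖ ^ 2 + 4 * R ^ 2) ^ 2 := by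
  have h : mvfderiv 𝓘(ℝ, 𝔼) (stereoFactor (n := n) R) x a =
      ((-(4 * R) / (‖x‖ ^ 2 + 4 * R ^ 2) ^ 2) • (2 • innerSL ℝ x)) a :=
    congrArg (fun f : 𝔼 →L[ℝ] ℝ ↦ f a) (hasFDerivAt_stereoFactor R x).hasMFDerivAt.mfderiv
  rw [h]
  simp only [smul_apply, nsmul_eq_mul, Nat.cast_ofNat, smul_eq_mul, innerSL_apply_apply]
  ring


/-- **The round metric pulled back by the scaled stereographic map is conformally flat**:
`⟪dι dΨ a, dι dΨ b⟫ = λ_R(x)² ⟪a, b⟫`. [folklore] -/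
theorem roundMetric_val_mfderiv_stereoScaled {R : ℝ} (hR : R ≠ 0) (x a b : 𝔼) :
    (roundMetric (n := n + 1) V).val (stereoScaled v R x)
      (mfderiv 𝓘(ℝ, 𝔼) (𝓡 (n + 1)) (stereoScaled (n := n) v R) x a)
      (mfderiv 𝓘(ℝ, 𝔼) (𝓡 (n + 1)) (stereoScaled (n := n) v R) x b) =
        stereoFactor (n := n) R x ^ 2 * ⟪a, b⟫ := by
  rw [roundMetric_val_eq_inner, mvfderiv_coe_mfderiv_stereoScaled, mvfderiv_coe_mfderiv_stereoScaled,
    inner_stereoInvDeriv, inner_smul_left, inner_smul_right, norm_smul, stereoFactor]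
  simp only [conj_trivial, norm_inv, Real.norm_eq_abs, mul_pow, inv_pow, sq_abs]
  have hx : 0 < ‖x‖ ^ 2 + 4 * R ^ 2 := by positivity
  field_simp

/-- **The conformally flat metric `λ_R² δ` on `ℝⁿ⁺¹`**, isometric by construction to the round
sphere minus the pole: the pullback of the round metric of `Sⁿ⁺¹` along the scaled inverse
stereographic map (`PseudoRiemannianMetric.comap`). [folklore] -/
abbrev stereoMetric {R : ℝ} (hR : R ≠ 0) :
    PseudoRiemannianMetric 𝓘(ℝ, 𝔼) ∞ 𝔼 (TangentSpace 𝓘(ℝ, 𝔼) : 𝔼 → Type _) :=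
  (roundMetric (n := n + 1) V).comap contMDiff_pullbackBilin_holds (stereoScaled (n := n) v R)
    (contMDiff_stereoScaled v R) (mfderiv_stereoScaled_injective v hR) rfl

/-- The values of the conformally flat metric: `λ_R(x)² ⟪a, b⟫`. [folklore] -/
theorem stereoMetric_apply {R : ℝ} (hR : R ≠ 0) (x a b : 𝔼) :
    (stereoMetric (n := n) v hR).val x a b = stereoFactor (n := n) R x ^ 2 * ⟪a, b⟫ :=
  roundMetric_val_mfderiv_stereoScaled v hR x a b

/-- `stereoMetric = λ_R² · (Euclidean metric)` fibrewise — the hypothesis `hval` of the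
conformal-change lemmas of `HypersurfaceConformal.lean` / `ConformalHessian.lean`. [folklore] -/
theorem stereoMetric_val_eq_smul {R : ℝ} (hR : R ≠ 0) (x : 𝔼) :
    (stereoMetric (n := n) v hR).val x = (stereoFactor (n := n) R x) ^ 2 • (euclideanMetric 𝔼).val x := by
  ext a b
  rw [stereoMetric_apply]
  simp only [smul_apply, euclideanMetric_apply, smul_eq_mul]
  rfl

/-- **The conformally flat metric has positive scalar curvature** `n(n+1)`: it is the round metric
of `Sⁿ⁺¹` pulled back (`scalarCurvature_comap`, `scalarCurvature_roundMetric_pos`). [folklore] -/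
theorem scalarCurvature_stereoMetric_pos [(roundMetric (n := n + 1) V).HasLeviCivita] {R : ℝ}
    (hR : R ≠ 0) [(stereoMetric (n := n) v hR).HasLeviCivita] (hn : 1 ≤ n) (x : 𝔼) :
    0 < (stereoMetric (n := n) v hR).scalarCurvature x := by
  have h := (roundMetric (n := n + 1) V).scalarCurvature_comap contMDiff_pullbackBilin_holds
    (contMDiff_stereoScaled v R) (mfderiv_stereoScaled_injective v hR) rfl x
  exact (scalarCurvature_roundMetric_pos V (by omega) _).trans_eq h.symm

end StereoScaled

end Literature.Geometry.Riemannian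

end
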